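import Literature.MathematicalPhysics.StatisticalMechanics.BarlowStackingEnergy
import Literature.Algebra.EuclideanLattices.CosetGaussianMass
import Literature.Algebra.EuclideanLattices.GaussianLatticeSums

/-!
# `PeriodicGivenLayered` (stmt-AtomisticToContinuum-11779), line `Sketch`, stub `stub_registry`, helper 3

The dual-lattice (Poisson) lower bound for the aligned-minus-offset Gaussian layer sum of the unit
triangular layer (card `alternating-majorisation-one-crossing`, step (5)): with
`θ¹_δ(t) = layerInteraction (fun r => Real.exp (-t * r ^ 2)) 1 0 δ 0 = ∑_{(i,j)} e^{-t ‖i u + j v + δ w‖²}`,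

  `θ¹_0(t) - θ¹_1(t) ≥ (18 π / (√3 t)) · e^{-4π²/(3t)}`   (`reg_first_shell_le`, all `t > 0`).

Proof: the shifted Poisson identity `tsum_gaussianFunction_sub_eq` (`GaussianLatticeSums.lean`) for the full
lattice `Λ = ℤ u + ℤ v ⊂ ℝ²` (covolume `√3/2`) gives
`θ¹_0(t) - θ¹_1(t) = (2π/(√3 t)) ∑_{ξ ∈ Λ*} e^{-π² ‖ξ‖²/t} (1 - cos 2π⟨w, ξ⟩)`, a series of non-negative terms; keep
the six shortest dual vectors `±ξ₁, ±ξ₂, ±(ξ₁ + ξ₂)` (`ξ₁ = (1, -1/√3)`, `ξ₂ = (0, 2/√3)`, `‖ξ‖² = 4/3`,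
`⟨w, ξ⟩ ≡ ∓1/3, ∓2/3`, `1 - cos = 3/2`). No new definitions.
-/

noncomputable section

namespace Summit.AtomisticToContinuum.Crystallization.Theorems.LayeredHull

open MeasureTheory Set Real Filter Module
open scoped BigOperators
open Literature.MathematicalPhysics.StatisticalMechanics Literature.Algebra.EuclideanLattices

/-! ## The planar triangular lattice `ℤ (1,0) + ℤ (1/2, √3/2)` as a full lattice of `ℝ²` -/

/-- The planar generators `(1, 0)`, `(1/2, √3/2)` are linearly independent. [folklore] -/
theorem reg_linearIndependent_plane :
    LinearIndependent ℝ ![(!₂[1, 0] : EuclideanSpace ℝ (Fin 2)), !₂[1 / 2, Real.sqrt 3 / 2]] := by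
  refine LinearIndependent.pair_iff.2 fun p q hpq => ?_
  have h0 := congrArg (fun v : EuclideanSpace ℝ (Fin 2) => v 0) hpq
  have h1 := congrArg (fun v : EuclideanSpace ℝ (Fin 2) => v 1) hpq
  simp only [PiLp.add_apply, PiLp.smul_apply, PiLp.zero_apply, smul_eq_mul] at h0 h1
  have h3 : Real.sqrt 3 ≠ 0 := by positivity
  have hq : q = 0 := by
    have : q * (Real.sqrt 3 / 2) = 0 := by simpa using h1
    simpa [h3] using this
  subst hq
  have hp : p = 0 := by simpa using h0
  exact ⟨hp, rfl⟩

/-- The `ℝ`-basis `(1,0), (1/2, √3/2)` of `ℝ²` (a term, used only inside this file's statements through its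
span). [folklore] -/
theorem reg_card_eq_finrank_plane : Fintype.card (Fin 2) = Module.finrank ℝ (EuclideanSpace ℝ (Fin 2)) := by simp

/-- The coordinates of the basis `basisOfLinearIndependentOfCardEqFinrank reg_linearIndependent_plane _`.
[folklore] -/
theorem reg_planeBasis_apply :
    ⇑(basisOfLinearIndependentOfCardEqFinrank reg_linearIndependent_plane reg_card_eq_finrank_plane) =
      ![(!₂[1, 0] : EuclideanSpace ℝ (Fin 2)), !₂[1 / 2, Real.sqrt 3 / 2]] :=
  coe_basisOfLinearIndependentOfCardEqFinrank _ _

/-- **Covolume of the unit triangular lattice**: `covol(ℤ (1,0) + ℤ (1/2, √3/2)) = √3/2`. [folklore] -/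
theorem reg_covolume_plane :
    ZLattice.covolume (Submodule.span ℤ (Set.range
      ⇑(basisOfLinearIndependentOfCardEqFinrank reg_linearIndependent_plane reg_card_eq_finrank_plane))) =
      Real.sqrt 3 / 2 := by
  classical
  set bT := basisOfLinearIndependentOfCardEqFinrank reg_linearIndependent_plane reg_card_eq_finrank_plane
    with hbT
  have h := ZLattice.covolume_eq_det_mul_measureReal (Submodule.span ℤ (Set.range ⇑bT)) volume
    (bT.restrictScalars ℤ) (EuclideanSpace.basisFun (Fin 2) ℝ).toBasis
  rw [h]
  have e1 : (Subtype.val ∘ ⇑(bT.restrictScalars ℤ) : Fin 2 → EuclideanSpace ℝ (Fin 2)) = ⇑bT := by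
    funext i
    simp [Module.Basis.restrictScalars_apply]
  have hvol : volume.real (ZSpan.fundamentalDomain (EuclideanSpace.basisFun (Fin 2) ℝ).toBasis) = 1 := by
    rw [measureReal_congr (ZSpan.fundamentalDomain_ae_parallelepiped _ volume), measureReal_def,
      OrthonormalBasis.coe_toBasis, OrthonormalBasis.volume_parallelepiped]
    simp
  rw [e1, Module.Basis.det_apply, Matrix.det_fin_two, hvol]
  simp only [Module.Basis.toMatrix_apply, OrthonormalBasis.coe_toBasis_repr_apply, EuclideanSpace.basisFun_repr]
  rw [hbT, reg_planeBasis_apply]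
  simp
  positivity

/-- Sums over the lattice `ℤ (1,0) + ℤ (1/2, √3/2)` are sums over `ℤ × ℤ`. [folklore] -/
theorem reg_tsum_span_plane (G : EuclideanSpace ℝ (Fin 2) → ℝ) :
    ∑' y : Submodule.span ℤ (Set.range
      ⇑(basisOfLinearIndependentOfCardEqFinrank reg_linearIndependent_plane reg_card_eq_finrank_plane)),
        G y =
      ∑' ij : ℤ × ℤ, G ((ij.1 : ℝ) • (!₂[1, 0] : EuclideanSpace ℝ (Fin 2)) +
        (ij.2 : ℝ) • !₂[1 / 2, Real.sqrt 3 / 2]) := by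
  set bT := basisOfLinearIndependentOfCardEqFinrank reg_linearIndependent_plane reg_card_eq_finrank_plane
  rw [tsum_prod_eq_tsum_fin_two]
  rw [← (bT.restrictScalars ℤ).equivFun.toEquiv.symm.tsum_eq]
  refine tsum_congr fun c => ?_
  congr 1
  change (((bT.restrictScalars ℤ).equivFun.symm c : Submodule.span ℤ (Set.range ⇑bT)) :
    EuclideanSpace ℝ (Fin 2)) = _
  rw [Literature.NumberTheory.LFunctions.Fourier.coe_restrictScalars_equivFun_symm, reg_planeBasis_apply]

/-- The planar lattice points realise the in-plane layer norms: aligned coset. [folklore] -/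
theorem reg_norm_plane_zero (i j : ℤ) :
    ‖(i : ℝ) • (!₂[1, 0] : EuclideanSpace ℝ (Fin 2)) + (j : ℝ) • !₂[1 / 2, Real.sqrt 3 / 2] - 0‖ ^ 2 =
      ‖layerVec 1 0 0 0 i j‖ ^ 2 := by
  rw [sub_zero, EuclideanSpace.norm_eq, Real.sq_sqrt (by positivity), Fin.sum_univ_two, norm_layerVec,
    Real.sq_sqrt (by positivity)]
  simp only [PiLp.add_apply, PiLp.smul_apply, smul_eq_mul, Real.norm_eq_abs, sq_abs]
  simp
  ring

/-- The planar lattice points realise the in-plane layer norms: offset coset (shift `x = -(1/2, √3/6)`).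
[folklore] -/
theorem reg_norm_plane_one (i j : ℤ) :
    ‖(i : ℝ) • (!₂[1, 0] : EuclideanSpace ℝ (Fin 2)) + (j : ℝ) • !₂[1 / 2, Real.sqrt 3 / 2] -
        (-(!₂[1 / 2, Real.sqrt 3 / 6] : EuclideanSpace ℝ (Fin 2)))‖ ^ 2 =
      ‖layerVec 1 0 1 0 i j‖ ^ 2 := by
  rw [sub_neg_eq_add, EuclideanSpace.norm_eq, Real.sq_sqrt (by positivity), Fin.sum_univ_two, norm_layerVec,
    Real.sq_sqrt (by positivity)]
  simp only [PiLp.add_apply, PiLp.smul_apply, smul_eq_mul, Real.norm_eq_abs, sq_abs]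
  simp
  ring

/-! ## The Poisson identity for the two cosets -/

/-- **The layer Gaussian sums in dual form**: for `t > 0` and a shift `x`,
`∑_{(i,j)} e^{-t ‖i u + j v - x‖²} = (2/√3)(π/t) ∑_{ξ ∈ Λ*} e^{-π² ‖ξ‖²/t} cos(2π⟨x, ξ⟩)`
(`tsum_gaussianFunction_sub_eq` with `s = √(π/t)`). [folklore] -/
theorem reg_tsum_plane_poisson {t : ℝ} (ht : 0 < t) (x : EuclideanSpace ℝ (Fin 2)) :
    ∑' ij : ℤ × ℤ, Real.exp (-t * ‖(ij.1 : ℝ) • (!₂[1, 0] : EuclideanSpace ℝ (Fin 2)) +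
        (ij.2 : ℝ) • !₂[1 / 2, Real.sqrt 3 / 2] - x‖ ^ 2) =
      2 / Real.sqrt 3 * (π / t) *
        ∑' w : dualLattice (Submodule.span ℤ (Set.range
          ⇑(basisOfLinearIndependentOfCardEqFinrank reg_linearIndependent_plane reg_card_eq_finrank_plane))),
          Real.exp (-(π ^ 2 * ‖(w : EuclideanSpace ℝ (Fin 2))‖ ^ 2 / t)) *
            Real.cos (2 * π * inner ℝ x (w : EuclideanSpace ℝ (Fin 2))) := by
  set L := Submodule.span ℤ (Set.range
    ⇑(basisOfLinearIndependentOfCardEqFinrank reg_linearIndependent_plane reg_card_eq_finrank_plane)) with hL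
  have hs : 0 < Real.sqrt (π / t) := Real.sqrt_pos.2 (div_pos Real.pi_pos ht)
  have key := tsum_gaussianFunction_sub_eq L hs x
  rw [reg_tsum_span_plane (fun y => gaussianFunction (Real.sqrt (π / t)) (y - x))] at key
  simp only [gaussianFunction_sqrt_pi_div ht] at key
  rw [key, reg_covolume_plane, finrank_euclideanSpace_fin, Real.sq_sqrt (div_pos Real.pi_pos ht).le]
  congr 1
  · field_simp
  · refine tsum_congr fun w => ?_
    congr 1
    rw [gaussianFunction, inv_pow, Real.sq_sqrt (div_pos Real.pi_pos ht).le]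
    congr 1
    field_simp

/-- The dual-side terms are summable. [folklore] -/
theorem reg_summable_dual {t : ℝ} (ht : 0 < t) (x : EuclideanSpace ℝ (Fin 2)) :
    Summable fun w : dualLattice (Submodule.span ℤ (Set.range
        ⇑(basisOfLinearIndependentOfCardEqFinrank reg_linearIndependent_plane reg_card_eq_finrank_plane))) =>
      Real.exp (-(π ^ 2 * ‖(w : EuclideanSpace ℝ (Fin 2))‖ ^ 2 / t)) *
        Real.cos (2 * π * inner ℝ x (w : EuclideanSpace ℝ (Fin 2))) := by
  have hs : Real.sqrt (π / t) ≠ 0 := (Real.sqrt_pos.2 (div_pos Real.pi_pos ht)).ne'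
  have h := summable_gaussianFunction_mul_cos (dualLattice (Submodule.span ℤ (Set.range
    ⇑(basisOfLinearIndependentOfCardEqFinrank reg_linearIndependent_plane reg_card_eq_finrank_plane))))
    (inv_ne_zero hs) x
  refine h.congr fun w => ?_
  congr 1
  rw [gaussianFunction, inv_pow, Real.sq_sqrt (div_pos Real.pi_pos ht).le]
  congr 1
  field_simp

/-! ## Six dual vectors and the first-shell lower bound -/

/-- Membership in the dual lattice from the two inner products with the generators. [folklore] -/
theorem reg_mem_dual_of_inner {ξ : EuclideanSpace ℝ (Fin 2)} (m₀ m₁ : ℤ)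
    (h0 : inner ℝ ξ (!₂[1, 0] : EuclideanSpace ℝ (Fin 2)) = m₀)
    (h1 : inner ℝ ξ (!₂[1 / 2, Real.sqrt 3 / 2] : EuclideanSpace ℝ (Fin 2)) = m₁) :
    ξ ∈ dualLattice (Submodule.span ℤ (Set.range
      ⇑(basisOfLinearIndependentOfCardEqFinrank reg_linearIndependent_plane reg_card_eq_finrank_plane))) := by
  rw [mem_dualLattice]
  intro y hy
  obtain ⟨c, rfl⟩ := (Submodule.mem_span_range_iff_exists_fun ℤ).1 hy
  refine ⟨c 0 * m₀ + c 1 * m₁, ?_⟩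
  rw [inner_sum, Fin.sum_univ_two, reg_planeBasis_apply]
  simp only [Matrix.cons_val_zero, Matrix.cons_val_one]
  rw [← Int.cast_smul_eq_zsmul ℝ, ← Int.cast_smul_eq_zsmul ℝ, inner_smul_right, inner_smul_right, h0, h1]
  push_cast
  ring

/-- Inner products in `ℝ²`, in coordinates. [folklore] -/
theorem reg_inner_fin_two (x y : EuclideanSpace ℝ (Fin 2)) : inner ℝ x y = x 0 * y 0 + x 1 * y 1 := by
  simp [PiLp.inner_apply, Fin.sum_univ_two, mul_comm]

/-- The integer combinations `m ξ₁ + n ξ₂` of `ξ₁ = (1, -√3/3)`, `ξ₂ = (0, 2√3/3)` lie in the dual of the unit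
triangular lattice (`⟨ξ₁, u⟩ = 1, ⟨ξ₁, v⟩ = 0, ⟨ξ₂, u⟩ = 0, ⟨ξ₂, v⟩ = 1`). [folklore] -/
theorem reg_mem_dual (m n : ℤ) :
    (m : ℝ) • (!₂[1, -(Real.sqrt 3 / 3)] : EuclideanSpace ℝ (Fin 2)) +
        (n : ℝ) • (!₂[0, 2 * Real.sqrt 3 / 3] : EuclideanSpace ℝ (Fin 2)) ∈
      dualLattice (Submodule.span ℤ (Set.range
        ⇑(basisOfLinearIndependentOfCardEqFinrank reg_linearIndependent_plane reg_card_eq_finrank_plane))) := by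
  have h3 : Real.sqrt 3 * Real.sqrt 3 = 3 := Real.mul_self_sqrt (by norm_num)
  refine Submodule.add_mem _ ?_ ?_
  · rw [Int.cast_smul_eq_zsmul]
    refine Submodule.smul_mem _ m (reg_mem_dual_of_inner 1 0 ?_ ?_) <;>
      (rw [reg_inner_fin_two]; norm_num <;> nlinarith [h3])
  · rw [Int.cast_smul_eq_zsmul]
    refine Submodule.smul_mem _ n (reg_mem_dual_of_inner 0 1 ?_ ?_) <;>
      (rw [reg_inner_fin_two]; norm_num <;> nlinarith [h3])

/-- **First-shell lower bound for the aligned-minus-offset Gaussian layer sum** (unit spacing): for `t > 0`,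
`(18 π / (√3 t)) e^{-4π²/(3t)} ≤ θ¹_0(t) - θ¹_1(t)`. By Poisson summation the difference is
`(2π/(√3 t)) ∑_{ξ ∈ Λ*} e^{-π² ‖ξ‖²/t} (1 - cos 2π⟨w, ξ⟩) ≥` the contribution `9 e^{-4π²/(3t)}` of the six
shortest dual vectors `±ξ₁, ±ξ₂, ±(ξ₁ + ξ₂)`. [folklore] -/
theorem reg_first_shell_le {t : ℝ} (ht : 0 < t) :
    18 * Real.pi / (Real.sqrt 3 * t) * Real.exp (-(4 * Real.pi ^ 2 / (3 * t))) ≤ layerInteraction (fun r => Real.exp (-t * r ^ 2)) 1 0 0 0 - layerInteraction (fun r => Real.exp (-t * r ^ 2)) 1 0 1 0 := by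
  have h3 : Real.sqrt 3 * Real.sqrt 3 = 3 := Real.mul_self_sqrt (by norm_num)
  have hs3 : 0 < Real.sqrt 3 := by positivity
  set L := Submodule.span ℤ (Set.range
    ⇑(basisOfLinearIndependentOfCardEqFinrank reg_linearIndependent_plane reg_card_eq_finrank_plane)) with hL
  set x₁ : EuclideanSpace ℝ (Fin 2) := -(!₂[1 / 2, Real.sqrt 3 / 6] : EuclideanSpace ℝ (Fin 2)) with hx₁
  -- the two cosets as planar Gaussian sums, in dual form
  have e0 : layerInteraction (fun r => Real.exp (-t * r ^ 2)) 1 0 0 0 = ∑' ij : ℤ × ℤ, Real.exp (-t * ‖(ij.1 : ℝ) • (!₂[1, 0] : EuclideanSpace ℝ (Fin 2)) +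
      (ij.2 : ℝ) • !₂[1 / 2, Real.sqrt 3 / 2] - 0‖ ^ 2) := by
    rw [layerInteraction]
    exact tsum_congr fun ij => by rw [reg_norm_plane_zero]
  have e1 : layerInteraction (fun r => Real.exp (-t * r ^ 2)) 1 0 1 0 = ∑' ij : ℤ × ℤ, Real.exp (-t * ‖(ij.1 : ℝ) • (!₂[1, 0] : EuclideanSpace ℝ (Fin 2)) +
      (ij.2 : ℝ) • !₂[1 / 2, Real.sqrt 3 / 2] - x₁‖ ^ 2) := by
    rw [layerInteraction]
    exact tsum_congr fun ij => by rw [hx₁, reg_norm_plane_one]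
  set f : dualLattice L → ℝ := fun w => Real.exp (-(π ^ 2 * ‖(w : EuclideanSpace ℝ (Fin 2))‖ ^ 2 / t)) *
    (1 - Real.cos (2 * π * inner ℝ x₁ (w : EuclideanSpace ℝ (Fin 2)))) with hf
  have hf0 : ∀ w, 0 ≤ f w := fun w =>
    mul_nonneg (Real.exp_pos _).le (sub_nonneg.2 (Real.cos_le_one _))
  have hfs : Summable f := by
    refine ((reg_summable_dual ht 0).sub (reg_summable_dual ht x₁)).congr fun w => ?_
    simp only [hf, inner_zero_left, mul_zero, Real.cos_zero, mul_one]
    ring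
  have hdiff : layerInteraction (fun r => Real.exp (-t * r ^ 2)) 1 0 0 0 - layerInteraction (fun r => Real.exp (-t * r ^ 2)) 1 0 1 0 = 2 / Real.sqrt 3 * (π / t) * ∑' w, f w := by
    rw [e0, e1, reg_tsum_plane_poisson ht 0, reg_tsum_plane_poisson ht x₁, ← mul_sub,
      ← Summable.tsum_sub (reg_summable_dual ht 0) (reg_summable_dual ht x₁)]
    congr 1
    refine tsum_congr fun w => ?_
    simp only [hf, inner_zero_left, mul_zero, Real.cos_zero, mul_one]
    ring
  -- the six shortest dual vectors, as an injective image of `ℤ × ℤ`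
  set ψ : ℤ × ℤ → dualLattice L := fun mn =>
    ⟨(mn.1 : ℝ) • (!₂[1, -(Real.sqrt 3 / 3)] : EuclideanSpace ℝ (Fin 2)) +
      (mn.2 : ℝ) • (!₂[0, 2 * Real.sqrt 3 / 3] : EuclideanSpace ℝ (Fin 2)), reg_mem_dual mn.1 mn.2⟩ with hψ
  have hψ0 : ∀ mn : ℤ × ℤ, (ψ mn : EuclideanSpace ℝ (Fin 2)) 0 = mn.1 := fun mn => by
    simp [hψ]
  have hψ1 : ∀ mn : ℤ × ℤ, (ψ mn : EuclideanSpace ℝ (Fin 2)) 1 = (2 * mn.2 - mn.1) * (Real.sqrt 3 / 3) :=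
    fun mn => by
    simp [hψ]
    ring
  have hψinj : Function.Injective ψ := by
    rintro ⟨m, n⟩ ⟨m', n'⟩ h
    have h0 := congrArg (fun w : dualLattice L => (w : EuclideanSpace ℝ (Fin 2)) 0) h
    have h1 := congrArg (fun w : dualLattice L => (w : EuclideanSpace ℝ (Fin 2)) 1) h
    simp only [hψ0, hψ1] at h0 h1
    have hm : m = m' := by exact_mod_cast h0
    subst hm
    have hn : (n : ℝ) = n' := by nlinarith [hs3]
    have hn' : n = n' := by exact_mod_cast hn
    rw [hn']
  have hnorm : ∀ mn : ℤ × ℤ, ‖(ψ mn : EuclideanSpace ℝ (Fin 2))‖ ^ 2 =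
      (mn.1 : ℝ) ^ 2 + (2 * mn.2 - mn.1) ^ 2 / 3 := fun mn => by
    rw [EuclideanSpace.norm_eq, Real.sq_sqrt (by positivity), Fin.sum_univ_two, Real.norm_eq_abs,
      Real.norm_eq_abs, sq_abs, sq_abs]
    rw [show (ψ mn : EuclideanSpace ℝ (Fin 2)).ofLp 0 = (ψ mn : EuclideanSpace ℝ (Fin 2)) 0 from rfl,
      show (ψ mn : EuclideanSpace ℝ (Fin 2)).ofLp 1 = (ψ mn : EuclideanSpace ℝ (Fin 2)) 1 from rfl, hψ0, hψ1]
    nlinarith [h3]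
  have hinner : ∀ mn : ℤ × ℤ, inner ℝ x₁ (ψ mn : EuclideanSpace ℝ (Fin 2)) = -((mn.1 : ℝ) + mn.2) / 3 :=
    fun mn => by
    rw [reg_inner_fin_two, hψ0, hψ1, hx₁]
    simp
    linear_combination (-(2 * (mn.2 : ℝ) - mn.1) / 18) * h3
  -- the value of `f` on the first shell
  have hc1 : Real.cos (2 * π / 3) = -(1 / 2) := by
    rw [show 2 * π / 3 = π - π / 3 by ring, Real.cos_pi_sub, Real.cos_pi_div_three]
  have hc2 : Real.cos (4 * π / 3) = -(1 / 2) := by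
    rw [show 4 * π / 3 = π / 3 + π by ring, Real.cos_add_pi, Real.cos_pi_div_three]
  set E := Real.exp (-(4 * π ^ 2 / (3 * t))) with hE
  set T : Finset (ℤ × ℤ) := {(1, 0), (-1, 0), (0, 1), (0, -1), (1, 1), (-1, -1)} with hT
  have hval : ∀ mn ∈ T, f (ψ mn) = 3 / 2 * E := by
    intro mn hmn
    have hfψ : f (ψ mn) = Real.exp (-(π ^ 2 * ((mn.1 : ℝ) ^ 2 + (2 * mn.2 - mn.1) ^ 2 / 3) / t)) *
        (1 - Real.cos (2 * π * (-((mn.1 : ℝ) + mn.2) / 3))) := by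
      simp only [hf, hnorm, hinner]
    rw [hfψ, hE]
    simp only [hT, Finset.mem_insert, Finset.mem_singleton] at hmn
    rcases hmn with rfl | rfl | rfl | rfl | rfl | rfl <;> push_cast
    · rw [show 2 * π * (-((1 : ℝ) + 0) / 3) = -(2 * π / 3) by ring, Real.cos_neg, hc1]
      rw [show -(π ^ 2 * ((1 : ℝ) ^ 2 + (2 * 0 - 1) ^ 2 / 3) / t) = -(4 * π ^ 2 / (3 * t)) by ring]
      ring
    · rw [show 2 * π * (-((-1 : ℝ) + 0) / 3) = 2 * π / 3 by ring, hc1]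
      rw [show -(π ^ 2 * ((-1 : ℝ) ^ 2 + (2 * 0 - -1) ^ 2 / 3) / t) = -(4 * π ^ 2 / (3 * t)) by ring]
      ring
    · rw [show 2 * π * (-((0 : ℝ) + 1) / 3) = -(2 * π / 3) by ring, Real.cos_neg, hc1]
      rw [show -(π ^ 2 * ((0 : ℝ) ^ 2 + (2 * 1 - 0) ^ 2 / 3) / t) = -(4 * π ^ 2 / (3 * t)) by ring]
      ring
    · rw [show 2 * π * (-((0 : ℝ) + -1) / 3) = 2 * π / 3 by ring, hc1]
      rw [show -(π ^ 2 * ((0 : ℝ) ^ 2 + (2 * -1 - 0) ^ 2 / 3) / t) = -(4 * π ^ 2 / (3 * t)) by ring]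
      ring
    · rw [show 2 * π * (-((1 : ℝ) + 1) / 3) = -(4 * π / 3) by ring, Real.cos_neg, hc2]
      rw [show -(π ^ 2 * ((1 : ℝ) ^ 2 + (2 * 1 - 1) ^ 2 / 3) / t) = -(4 * π ^ 2 / (3 * t)) by ring]
      ring
    · rw [show 2 * π * (-((-1 : ℝ) + -1) / 3) = 4 * π / 3 by ring, hc2]
      rw [show -(π ^ 2 * ((-1 : ℝ) ^ 2 + (2 * -1 - -1) ^ 2 / 3) / t) = -(4 * π ^ 2 / (3 * t)) by ring]
      ring
  have hsumT : ∑ mn ∈ T, f (ψ mn) = 9 * E := by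
    rw [Finset.sum_congr rfl hval, Finset.sum_const]
    rw [show T.card = 6 by rfl]
    simp
    ring
  -- assemble: `∑' f ≥ ∑' f ∘ ψ ≥ ∑_T f ∘ ψ = 9 E`
  have h1 : ∑' mn : ℤ × ℤ, f (ψ mn) ≤ ∑' w, f w :=
    Summable.tsum_le_tsum_of_inj ψ hψinj (fun w _ => hf0 w) (fun mn => le_rfl) (hfs.comp_injective hψinj) hfs
  have h2 : ∑ mn ∈ T, f (ψ mn) ≤ ∑' mn : ℤ × ℤ, f (ψ mn) :=
    Summable.sum_le_tsum T (fun mn _ => hf0 _) (hfs.comp_injective hψinj)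
  rw [hdiff]
  have hC : 0 ≤ 2 / Real.sqrt 3 * (π / t) := by positivity
  calc 18 * π / (Real.sqrt 3 * t) * E = 2 / Real.sqrt 3 * (π / t) * (9 * E) := by
        field_simp
        ring
    _ ≤ 2 / Real.sqrt 3 * (π / t) * ∑' w, f w := by
        refine mul_le_mul_of_nonneg_left ?_ hC
        rw [← hsumT]
        exact h2.trans h1

end Summit.AtomisticToContinuum.Crystallization.Theorems.LayeredHull
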